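import Mathlib.Probability.Distributions.Gaussian.Real
import Mathlib.Topology.Instances.AddCircle.Real
import Mathlib.MeasureTheory.Integral.IntervalIntegral.Periodic
import Mathlib.MeasureTheory.MeasurableSpace.Instances
import Mathlib.MeasureTheory.Function.Floor
import Mathlib.Probability.ProbabilityMassFunction.Basic
import Mathlib.Probability.Distributions.Uniform
import Mathlib.Algebra.Order.Round
import Mathlib.Algebra.Polynomial.Eval.Defs
import Mathlib.Order.Filter.AtTopBot.Basic
import Literature.Computability.Cryptography.LWE
import HarnessLib

-- provenance: harness21/H21/H21/Prelude/Lattice/LWENoise.lean @ ec52c55 (interim HEAD d8f2665); M5 mechanical rewrite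
/-!
# LWE error distributions and Regev's parameter regime (trunk T-LATTICE, G10)

This file provides the concrete error distributions of Regev's *Learning With Errors* problem and the
parameter regime of the main theorem:

* `Literature.LWE.wrappedGaussian α` — the distribution `Ψ_α` on the torus `𝕋 = ℝ/ℤ`: a centred normal variable of
  standard deviation `α/√(2π)` (variance `α²/(2π)`) reduced modulo `1` (Regev 2009, §2);
* `Literature.LWE.discretize q`, `Literature.LWE.discretizeCircle q` — the rounding map `x ↦ ⌊q x⌉ mod q` from `ℝ`
  (resp. `𝕋`) to `ZMod q`;
* `Literature.LWE.discretizedGaussian q α` — `Ψ̄_α`, the law of `⌊q X⌉ mod q` for `X ∼ N(0, α²/(2π))`, as a `PMF`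
  on `ZMod q` (Regev 2009, §2), i.e. the noise `χ` fed to `Literature.Computability.Cryptography.LWE.lweSample`;
* `Literature.LWE.torusLWESample q φ s` — Regev's continuous-noise distribution `A_{s,φ}` on `ℤ_qⁿ × 𝕋`
  (Regev 2009, §2 and §4), as a `Measure`;
* `Literature.Computability.Cryptography.LWE.IsPolyBounded`, `Literature.LWE.RegevRegime q α c₀` — the asymptotic parameter regime of the summit
  statement (summits/fw-lwe-bqp): `q` polynomially bounded, `α q ≥ 2√n`, `1/α ≤ n^{c₀}`.

## Mathlib

Mathlib has the real Gaussian `ProbabilityTheory.gaussianReal` (mean, variance as `ℝ≥0`), the circle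
`UnitAddCircle = AddCircle (1 : ℝ)` with its Borel structure and `AddCircle.measurable_mk'`,
`AddCircle.liftIco`, `AddCircle.measurableEquivIco`, `round`, `Int.measurable_floor`, `ZMod.instMeasurableSpace`
(the `⊤` σ-algebra), `PMF.uniformOfFintype`, `Measure.toPMF`; all are used here.  Mathlib has no wrapped or
discretised Gaussian and no LWE material.

## Design

* `Ψ_α` has variance `α²/(2π)`, *not* `α²` (Regev's normalisation `ρ_α(x) = exp(-π (x/α)²)`); the variance is
  passed to `gaussianReal` through `Real.toNNReal`, which is harmless since `α²/(2π) ≥ 0`.  For `α = 0` the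
  Gaussian degenerates to a Dirac mass (Mathlib's convention), so `Ψ_0 = δ_0`.
* `torusLWESample` is an honest pushforward of a probability measure along a map proved measurable
  (`measurable_torusSampleMap`), so no `Measure.map` junk value can occur; the finite factor `ι → ZMod q`
  carries Mathlib's product σ-algebra `MeasurableSpace.pi`, which is discrete here.
* In `RegevRegime` the analytic conditions are *eventual* in `n` (all consumers — `pqc.S01`, `pqc.S02`,
  `pqc.S19` — are asymptotic, and the pointwise version is contradictory at `n = 0`), while `2 ≤ q n` is
  pointwise so that `ZMod (q n)` is a nontrivial finite ring for every `n`.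
* Flag: the summit statement (`pqc.S01`) uses `α q ≥ 2√n`, whereas Regev 2009, Thm 1.1 (`pqc.S19`) assumes
  the strict inequality `α q > 2√n`.  `RegevRegime` records the weak form; statement files say so.

## References

* O. Regev, *On lattices, learning with errors, random linear codes, and cryptography*, J. ACM 56 (2009),
  §2 (definitions of `Ψ_α`, `Ψ̄_α`, `A_{s,χ}`), Thm 1.1, §4.
* summits/fw-lwe-bqp/SUMMIT.md (parameter regime).
-/

noncomputable section

open MeasureTheory ProbabilityTheory Filter
open scoped ENNReal NNReal

namespace Literature.Computability.Cryptography

namespace LWE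

/-! ### The wrapped Gaussian `Ψ_α` on the torus -/

/-- The quotient map `ℝ → 𝕋 = ℝ/ℤ` is measurable (this is Mathlib's `AddCircle.measurable_mk'`,
restated for `UnitAddCircle`). [folklore] -/
theorem measurable_coe_unitAddCircle : Measurable (fun x : ℝ ↦ (x : UnitAddCircle)) :=
  AddCircle.measurable_mk'

/-- Regev's error distribution `Ψ_α` on the torus `𝕋 = ℝ/ℤ`: the law of `X mod 1` where `X` is a centred
real Gaussian of standard deviation `α/√(2π)`, i.e. variance `α²/(2π)` (Regev 2009, §2: the density of `X`
is `α⁻¹ exp(-π (x/α)²)`). [cite: Regev2009, §2: the density of  X  is  α⁻¹ exp(-π (x] -/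
def wrappedGaussian (α : ℝ) : Measure UnitAddCircle :=
  (gaussianReal 0 (Real.toNNReal (α ^ 2 / (2 * Real.pi)))).map (fun x : ℝ ↦ (x : UnitAddCircle))

/-- `Ψ_α` is a probability measure (pushforward of a probability measure along a measurable map). [folklore] -/
instance instIsProbabilityMeasureWrappedGaussian (α : ℝ) : IsProbabilityMeasure (wrappedGaussian α) :=
  Measure.isProbabilityMeasure_map measurable_coe_unitAddCircle.aemeasurable

/-! ### Discretisation `ℝ → ZMod q` and `𝕋 → ZMod q` -/

/-- The discretisation map `x ↦ ⌊q x⌉ mod q` from `ℝ` to `ZMod q` (round `q x` to the nearest integer and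
reduce modulo `q`), used by Regev (2009, §2) to pass from `Ψ_α` on `𝕋` to `Ψ̄_α` on `ℤ_q`. [cite: Regev2009, §2] -/
def discretize (q : ℕ) : ℝ → ZMod q :=
  fun x ↦ ((round ((q : ℝ) * x) : ℤ) : ZMod q)

/-- The discretisation map is measurable (`ZMod q` carries the discrete σ-algebra; `round x = ⌊x + 1/2⌋`
and `Int.floor` is measurable). [folklore] -/
theorem measurable_discretize (q : ℕ) : Measurable (discretize q) := by
  have hround : Measurable (round : ℝ → ℤ) := by
    have : (round : ℝ → ℤ) = fun x ↦ ⌊x + 1 / 2⌋ := funext round_eq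
    rw [this]
    exact Int.measurable_floor.comp (measurable_id.add_const _)
  exact (measurable_from_top (f := fun z : ℤ ↦ (z : ZMod q))).comp
    (hround.comp (measurable_id.const_mul _))

/-- The discretisation map is invariant under integer shifts:
`⌊q (x + n)⌉ = ⌊q x⌉ + q n ≡ ⌊q x⌉ (mod q)`. [folklore] -/
theorem discretize_add_intCast (q : ℕ) (x : ℝ) (n : ℤ) : discretize q (x + n) = discretize q x := by
  simp only [discretize, mul_add]
  rw [show (q : ℝ) * (n : ℝ) = ((q * n : ℤ) : ℝ) by push_cast; ring, round_add_intCast]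
  simp

/-- The discretisation map is `1`-periodic: `⌊q (x + 1)⌉ = ⌊q x⌉ + q ≡ ⌊q x⌉ (mod q)`. [folklore] -/
theorem discretize_add_one (q : ℕ) (x : ℝ) : discretize q (x + 1) = discretize q x := by
  simpa using discretize_add_intCast q x 1

/-- The discretisation map descended to the torus: `discretizeCircle q : 𝕋 → ZMod q` sends the class of
`x ∈ [0, 1)` to `⌊q x⌉ mod q`; well defined by `discretize_add_one` (Regev 2009, §2).  Implemented with
Mathlib's `AddCircle.liftIco`. [cite: Regev2009, §2] -/
def discretizeCircle (q : ℕ) : UnitAddCircle → ZMod q :=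
  AddCircle.liftIco 1 0 (discretize q)

/-- `discretizeCircle q` agrees with `discretize q` on representatives. [folklore] -/
theorem discretizeCircle_coe (q : ℕ) (x : ℝ) :
    discretizeCircle q (x : UnitAddCircle) = discretize q x := by
  have hfr : Int.fract x ∈ Set.Ico (0 : ℝ) (0 + 1) := by
    rw [zero_add]; exact ⟨Int.fract_nonneg x, Int.fract_lt_one x⟩
  have hz : ((⌊x⌋ : ℝ) : UnitAddCircle) = 0 :=
    (AddCircle.coe_eq_zero_iff 1).2 ⟨⌊x⌋, by simp⟩
  have hx : (x : UnitAddCircle) = ((Int.fract x : ℝ) : UnitAddCircle) := by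
    conv_lhs => rw [← Int.fract_add_floor x]
    rw [AddCircle.coe_add, hz, add_zero]
  rw [hx, discretizeCircle, AddCircle.liftIco_coe_apply hfr]
  conv_rhs => rw [← Int.fract_add_floor x, discretize_add_intCast]

/-- The discretisation map on the torus is measurable. [folklore] -/
theorem measurable_discretizeCircle (q : ℕ) : Measurable (discretizeCircle q) := by
  unfold discretizeCircle AddCircle.liftIco
  exact ((measurable_discretize q).comp measurable_subtype_coe).comp
    (AddCircle.measurableEquivIco 1 0).measurable

/-! ### The discretised Gaussian `Ψ̄_α` on `ZMod q` -/

/-- Regev's discretised Gaussian `Ψ̄_α` on `ℤ_q`: the law of `⌊q X⌉ mod q` where `X ∼ N(0, α²/(2π))`,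
equivalently the pushforward of `Ψ_α` under `discretizeCircle q` (Regev 2009, §2).  This is the noise
distribution `χ` of the LWE problem `LWE_{q,Ψ̄_α}` (fed to `Literature.Computability.Cryptography.LWE.lweSample`). [cite: Regev2009, §2] -/
def discretizedGaussian (q : ℕ) [NeZero q] (α : ℝ) : PMF (ZMod q) :=
  haveI : IsProbabilityMeasure
      ((gaussianReal 0 (Real.toNNReal (α ^ 2 / (2 * Real.pi)))).map (discretize q)) :=
    Measure.isProbabilityMeasure_map (measurable_discretize q).aemeasurable
  ((gaussianReal 0 (Real.toNNReal (α ^ 2 / (2 * Real.pi)))).map (discretize q)).toPMF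

/-- Bridge: `Ψ̄_α` is the pushforward of `Ψ_α` along `discretizeCircle q` (Regev 2009, §2). [cite: Regev2009, §2] -/
theorem discretizedGaussian_eq_map_wrappedGaussian (q : ℕ) [NeZero q] (α : ℝ) :
    (discretizedGaussian q α).toMeasure = (wrappedGaussian α).map (discretizeCircle q) := by
  rw [discretizedGaussian, Measure.toPMF_toMeasure, wrappedGaussian,
    Measure.map_map (measurable_discretizeCircle q) measurable_coe_unitAddCircle]
  congr 1
  funext x
  exact (discretizeCircle_coe q x).symm

/-- Mass formula: `Ψ̄_α(k)` is the Gaussian mass of the preimage `{x | ⌊q x⌉ ≡ k (mod q)}`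
(Regev 2009, §2). [cite: Regev2009, §2] -/
theorem discretizedGaussian_apply (q : ℕ) [NeZero q] (α : ℝ) (k : ZMod q) :
    discretizedGaussian q α k =
      gaussianReal 0 (Real.toNNReal (α ^ 2 / (2 * Real.pi))) (discretize q ⁻¹' {k}) := by
  rw [discretizedGaussian, Measure.toPMF_apply,
    Measure.map_apply (measurable_discretize q) (measurableSet_singleton k)]

/-! ### Regev's continuous-noise distribution `A_{s,φ}` on `ℤ_qⁿ × 𝕋` -/

section Torus

variable {ι : Type} [Fintype ι] [DecidableEq ι] (q : ℕ) [NeZero q]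

/-- The deterministic part of a torus LWE sample: `(a, e) ↦ (a, ⟨a, s⟩/q + e)` on `ℤ_q^ι × 𝕋`, where
`⟨a, s⟩ ∈ ℤ_q` is lifted to its representative in `[0, q)` before dividing by `q` (Regev 2009, §2,
definition of `A_{s,φ}`). [cite: Regev2009, §2  definition of  A_{s φ}] -/
def torusSampleMap (s : ι → ZMod q) :
    (ι → ZMod q) × UnitAddCircle → (ι → ZMod q) × UnitAddCircle :=
  fun p ↦ (p.1, ((((p.1 ⬝ᵥ s).val : ℝ) / q : ℝ) : UnitAddCircle) + p.2)

omit [DecidableEq ι] in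
/-- `torusSampleMap q s` is measurable: the first factor is a countable discrete measurable space and, for
fixed `a`, the second component is a translation of the circle. [folklore] -/
theorem measurable_torusSampleMap (s : ι → ZMod q) : Measurable (torusSampleMap q s) := by
  refine measurable_from_prod_countable_right (fun a ↦ ?_)
  show Measurable fun y : UnitAddCircle ↦ (a, ((((a ⬝ᵥ s).val : ℝ) / q : ℝ) : UnitAddCircle) + y)
  exact measurable_const.prodMk (measurable_id.const_add _)

/-- Regev's LWE distribution with continuous noise `A_{s,φ}` on `ℤ_q^ι × 𝕋`: draw `a` uniformly from
`ℤ_q^ι`, `e ← φ`, and output `(a, ⟨a, s⟩/q + e)` (Regev 2009, §2 and §4; used with `φ = Ψ_α`). [cite: Regev2009, §2 and §4] -/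
def torusLWESample (φ : Measure UnitAddCircle) (s : ι → ZMod q) :
    Measure ((ι → ZMod q) × UnitAddCircle) :=
  (((PMF.uniformOfFintype (ι → ZMod q)).toMeasure).prod φ).map (torusSampleMap q s)

/-- `A_{s,φ}` is a probability measure whenever `φ` is. [folklore] -/
instance instIsProbabilityMeasureTorusLWESample (φ : Measure UnitAddCircle) [IsProbabilityMeasure φ]
    (s : ι → ZMod q) : IsProbabilityMeasure (torusLWESample q φ s) :=
  Measure.isProbabilityMeasure_map (measurable_torusSampleMap q s).aemeasurable

end Torus

/-! ### The parameter regime -/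

/-- A function `f : ℕ → ℕ` is *polynomially bounded* if `f n ≤ p(n)` for some polynomial `p` with natural
coefficients (the regime "`q ≤ poly(n)`" of Regev 2009, Thm 1.1). [cite: Regev2009, Thm 1.1] -/
def IsPolyBounded (f : ℕ → ℕ) : Prop :=
  ∃ p : Polynomial ℕ, ∀ n, f n ≤ p.eval n

/-- Regev's parameter regime for `LWE_{q(n), Ψ_{α(n)}}` in dimension `n` (summits/fw-lwe-bqp; Regev 2009,
Thm 1.1): the modulus `q` is polynomially bounded with `q n ≥ 2` for every `n`, and *eventually* in `n`,
`0 < α n`, `α n · q n ≥ 2√n` and `1/α n ≤ n^{c₀}`.  Flag: the summit (`pqc.S01`) uses the weak inequality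
`α q ≥ 2√n` recorded here, whereas Regev 2009, Thm 1.1 (`pqc.S19`) assumes `α q > 2√n`. [cite: Regev2009, Thm 1.1] -/
def RegevRegime (q : ℕ → ℕ) (α : ℕ → ℝ) (c₀ : ℕ) : Prop :=
  IsPolyBounded q ∧ (∀ n, 2 ≤ q n) ∧
    ∀ᶠ n : ℕ in atTop, 0 < α n ∧ 2 * Real.sqrt n ≤ α n * q n ∧ 1 / α n ≤ (n : ℝ) ^ c₀

/-- In Regev's regime every modulus `q n` is nonzero, so `ZMod (q n)` is a finite ring. [folklore] -/
theorem RegevRegime.neZero {q : ℕ → ℕ} {α : ℕ → ℝ} {c₀ : ℕ} (h : RegevRegime q α c₀) (n : ℕ) :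
    NeZero (q n) :=
  ⟨by have := h.2.1 n; omega⟩

/-- In Regev's regime the modulus is polynomially bounded. [folklore] -/
theorem RegevRegime.isPolyBounded {q : ℕ → ℕ} {α : ℕ → ℝ} {c₀ : ℕ} (h : RegevRegime q α c₀) :
    IsPolyBounded q :=
  h.1

/-- The regime is nonempty: `q n = 4 (n + 1)²`, `α n = 1/(n + 1)`, `c₀ = 2` satisfy it
(`α q = 4 (n + 1) ≥ 2√n` and `1/α = n + 1 ≤ n²` for `n ≥ 2`). [folklore] -/
theorem regevRegime_example :
    RegevRegime (fun n ↦ 4 * (n + 1) ^ 2) (fun n ↦ 1 / ((n : ℝ) + 1)) 2 := by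
  refine ⟨⟨4 * (Polynomial.X + 1) ^ 2, fun n ↦ by simp⟩,
    fun n ↦ by nlinarith [sq_nonneg (n + 1), Nat.zero_le n], ?_⟩
  filter_upwards [eventually_ge_atTop 2] with n hn
  have hn' : (2 : ℝ) ≤ n := by exact_mod_cast hn
  refine ⟨by positivity, ?_, ?_⟩
  · push_cast
    rw [show 1 / ((n : ℝ) + 1) * (4 * ((n : ℝ) + 1) ^ 2) = 4 * ((n : ℝ) + 1) by field_simp]
    have h1 : Real.sqrt n ≤ (n : ℝ) + 1 := by
      rw [Real.sqrt_le_left (by positivity)]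
      nlinarith
    linarith
  · rw [one_div_one_div]
    nlinarith

end LWE

end Literature.Computability.Cryptography

end
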